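import Summits.HodgeConjecture.HodgeConjecture.Theorems.Ring2HypothesesDescentAbsoluteDomination
import Summits.HodgeConjecture.HodgeConjecture.Theorems.Ring2HypothesesDescentAbsoluteDeligneStrictClass
import Summits.HodgeConjecture.HodgeConjecture.Theorems.Ring2HypothesesDescentAbsoluteHalving
import Summits.HodgeConjecture.HodgeConjecture.Theorems.Ring2HypothesesDescentCurvePowersMiddle
import HarnessLib

/-!
# Ring 2 — hypotheses layer, descent axis: ROW b06 IS «THE MIDDLE-DIMENSIONAL ABSOLUTE HODGE CLASSES ON THE EVEN POWERS
# `C^{2m}` (m ≥ 2) OF SMOOTH PROJECTIVE CURVES ARE ALGEBRAIC» — modulo the class-level facts of Deligne's §2, without c1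

HONEST FRAMING (page 1, verbatim the cell's standing line): **research route conditional on HC_CM; not a
corollary; Q11.4-sentence-2 already refuted in dim ≥ 3.** Nothing in this file proves a case of the Hodge conjecture;
nothing discharges the binder of record b06 `Ring2.Hypotheses.AbsoluteHodgeImpliesAlgebraicAV` («absolute Hodge classes
on complex abelian varieties are algebraic», `Ring2HypothesesDescent.lean` :73; OPEN); the binder table's numbers do not
move. `HC_CM` (`Theses.RankFourFaces.CMAbelianHodge`) and `HC_AV` do not occur in this file; row b06 occurs only inside `↔` /
under `¬`, and is NOT asserted.

Hodge ladder STAGE 3, `BINDER-OWNERS.md` row **b06**, seat `ring2-b06` (gen 76, file 6). Gen 75 read `HC_AV`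
hypothesis-free as «the middle rational Hodge classes of `C^{2m}` (`m ≥ 2`) are algebraic» (`hc_av_iff_curvePow_middleDegree`,
Brosnan–Fang–Nie–Pearlstein Lemma 48 padding BY THE CURVE ITSELF: `Cᴺ × C = Cᴺ⁺¹`). The companions of this gen put ROW b06
on the curve powers WITHOUT Deligne's Main Theorem (`absoluteHodgeImpliesAlgebraicAV_iff_curvePow_of_facts`, mod the six
§2 facts of record). THIS FILE pads absolute Hodge classes: for the slice `s = (𝟙, y) : X → X × Y`, `s_! c` of an absolute
Hodge class `c` lies in `S(X ⊗ Y) = span_ℂ AH` (Gysin maps of ALL morphisms preserve `S`, companion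
`complexGysin_mem_span_absoluteHodge`, CS 11.2.8), is a non-zero multiple of a RATIONAL class (the tree's
`exists_smul_isRationalClass_complexGysin`), and a rational class of `S` is absolute Hodge (companion
`isAbsoluteHodgeClass_of_isRationalClass_of_mem_span`, rational descent, mod (N)+(E)); and `c = pr_{1!} s_! c`. All MODULO
the facts OF RECORD (displayed; none new, none discharged): (N) `chartConjugation_canonical`, (E), (V-B3)
`deligne1982_cycleClass_absoluteHodge`, (T1c) `deligne1982_lefschetz_absoluteHodge_iff`, (CS7)
`deligne1982_cupProduct_absoluteHodge`, (CS8) `deligne1982_gysinFst_absoluteHodge`.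

* §1 `absoluteHodge_algebraic_of_tensor_padding` — BFNP Lemma 48 (product half) for ABSOLUTE Hodge classes with a general
  smooth projective padding factor `(Y, y)` (mod (N)+(E)+V-B3+CS7+CS8): if the absolute Hodge classes of codimension `p + r`
  on `X ⊗ Y` are algebraic, so are those of codimension `p` on `X`.
* §2 `absoluteHodge_algebraic_curvePow_of_padding` (pad `k` times by `C`) and
  **`absoluteHodge_algebraic_curvePow_of_forall_middleDegree` — PER CURVE: if for every `m ≥ 2` every absolute Hodge class
  in the middle degree `H^{2m}` of `C^{2m}` is algebraic, then on every `Cᴺ` every absolute Hodge class is algebraic**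
  (lower half by padding into the middle of `C^{2(N-p)}`, codimension `≤ 1` by Lefschetz `(1,1)`, upper half by T1c —
  gen 68's `forall_absoluteHodge_algebraic_of_lowerHalf`).
* §3 **`absoluteHodgeImpliesAlgebraicAV_iff_curvePow_middleDegree_of_facts` — ROW b06 ⟺ FOR EVERY SMOOTH PROJECTIVE
  COMPLEX CURVE `C` AND EVERY `m ≥ 2`, EVERY ABSOLUTE HODGE CLASS IN `H^{2m}((C^{2m})(ℂ); ℂ)` IS ALGEBRAIC** (mod the six
  facts; first open instance `m = 2`: `H⁴` of `C⁴`), the `¬`-form, and — with the companion's DM II 6.27 (granted c1,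
  displayed) — the same with «absolute Hodge» replaced by «rational `(m,m)`» recovers gen 75's hypothesis-free reading
  as the c1-end of the square.

HONEST COLUMN. Nothing is discharged; «10 · 0» unchanged; row b06 never asserted; the facts are OF RECORD and occur only
as hypotheses; no definition, no new named fact, no sorry. NOT obtained: a genus bound; `m = 2` alone (padding raises `m`).

PRESEARCH: [corpus: paper:arxiv-0705.2271 / BrosnanFangNiePearlstein2009 §6 Lemma 48 (the Hodge-class padding, the
lane's locator of gen 69–75)]; corpus hybrid + galaxy all stars «absolute Hodge|powers of curves»: no printed AH form —
certification by assembly, no novelty in print claimed.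

References (bib keys): BrosnanFangNiePearlstein2009 (§6 Lemma 48), KerrPearlstein2011 (§3.1), CharlesSchnell2014Notes
(Def. 11.2.3, Prop. 11.2.8, 11.2.18), Deligne1982HodgeCycles (§2 Ex. 2.1 (a), (c)), DeligneMilne1982Tannakian (II Prop.
6.5, Cor. 6.27), Arapura2006 (§1 Lemma 1.3, §4 Lemma 4.2), VoisinHodgeI2002 (§7.3.2 Lemma 7.30, Thm. 11.30),
FultonYoungTableaux1997 (App. B §B.1).
-/

noncomputable section

set_option linter.dupNamespace false

open CategoryTheory CategoryTheory.Limits AlgebraicGeometry MonoidalCategory CartesianMonoidalCategory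
open Literature.AlgebraicGeometry Literature.AlgebraicGeometry.Motives
open Literature.AlgebraicGeometry.HodgeTheory
open Literature.AlgebraicTopology.SingularHomology

namespace Summit.HodgeConjecture.HodgeConjecture.Ring2.Hypotheses

/-! ## §1 BFNP Lemma 48 padding for absolute Hodge classes (mod (N)+(E) + V-B3 + CS7 + CS8) -/

section Padding

variable {n r p : ℕ} {X Y : SchemeOver ℂ}

/-- **Padding an absolute Hodge class by a general smooth projective factor.** `X`, `Y` smooth projective of dimensions
`n`, `r`, `y ∈ Y(ℂ)`, `p ≤ n`; suppose every ABSOLUTE HODGE class of codimension `p + r` on `X ⊗ Y` is algebraic. Then every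
absolute Hodge class `c ∈ H²ᵖ(X(ℂ); ℂ)` is algebraic: for the slice `s = (𝟙, y) : X → X ⊗ Y` and the complex orientations,
`s_! c ∈ S^{p+r}(X ⊗ Y)` (the Gysin map of every morphism preserves `S = span_ℂ AH`, CS 11.2.8 — companion
`complexGysin_mem_span_absoluteHodge`), `s_! c = u • ρ` with `u ≠ 0` and `ρ` RATIONAL (`exists_smul_isRationalClass_complexGysin`),
so `ρ ∈ S` is absolute Hodge (rational descent, `isAbsoluteHodgeClass_of_isRationalClass_of_mem_span`), hence algebraic,
and `c = pr_{1!} (s_! c) ∈ pr_{1!} N^{p+r} ⊆ Nᵖ`. Verbatim gen 75's `mem_algebraicClasses_of_tensor_padding` with «rational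
`(p,p)`» ↦ «absolute Hodge». The hypothesis is NOT asserted. [cite: BrosnanFangNiePearlstein2009, §6 Lemma 48]
[cite: CharlesSchnell2014Notes, Prop. 11.2.8 (1)–(2)] [cite: FultonYoungTableaux1997, App. B §B.1, §B.2 Ex. 5] -/
theorem absoluteHodge_algebraic_of_tensor_padding (hN : chartConjugation_canonical)
    (hex : ∀ ⦃n : ℕ⦄ ⦃X : SchemeOver ℂ⦄, IsSmoothProjective n X →
      ∀ (σ : ℂ ≃+* ℂ) (p : ℕ) (c : complexBetti X (2 * p)), ∃ s, IsConjugateClass σ X (2 * p) c s)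
    (hZ : deligne1982_cycleClass_absoluteHodge) (hcup : deligne1982_cupProduct_absoluteHodge)
    (hgys : deligne1982_gysinFst_absoluteHodge) (hX : IsSmoothProjective n X) (hY : IsSmoothProjective r Y)
    (y : AlgPoints Y ℂ) (hpn : p ≤ n)
    (hpad : ∀ c' : complexBetti (X ⊗ Y) (2 * (p + r)), IsAbsoluteHodgeClass (n + r) (X ⊗ Y) (p + r) c' →
      c' ∈ algebraicClasses (X ⊗ Y) (p + r))
    (c : complexBetti X (2 * p)) (hc : IsAbsoluteHodgeClass n X p c) : c ∈ algebraicClasses X p := by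
  have hμ : complexOrientationFamily.HasPoincareDuality := hasPoincareDuality_complexOrientationFamily
  have hXP : IsSmoothProjective (n + r) (X ⊗ Y) := IsSmoothProjective.tensor_holds hX hY
  have hab : 2 * p + 2 * (n + r) = 2 * (p + r) + 2 * n := by omega
  -- the slice `s = (𝟙, y) : X ⟶ X ⊗ Y` and `c' := s_! c ∈ S(X ⊗ Y)`
  obtain ⟨c', hc'def⟩ : ∃ c' : complexBetti (X ⊗ Y) (2 * (p + r)),
      complexGysin complexOrientationFamily hX hXP (Motives.sliceAt X y) hab c = c' := ⟨_, rfl⟩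
  have hc'S : c' ∈ Submodule.span ℂ {c : complexBetti (X ⊗ Y) (2 * (p + r)) |
      IsAbsoluteHodgeClass (n + r) (X ⊗ Y) (p + r) c} := by
    rw [← hc'def]
    exact complexGysin_mem_span_absoluteHodge hN hex hZ hcup hgys hX hXP (Motives.sliceAt X y) hab
      (Submodule.subset_span hc)
  -- `c' = u • ρ`, `u ≠ 0`, `ρ` rational — hence `ρ ∈ S` is absolute Hodge, hence algebraic
  obtain ⟨u, hu0, hu⟩ := exists_smul_isRationalClass_complexGysin complexOrientationFamily hX hXP (Motives.sliceAt X y) hab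
  obtain ⟨ρ, hρrat, hρ⟩ := hu c hc.isRationalClass
  have hρeq : ρ = u⁻¹ • c' := by
    rw [← hc'def, hρ, smul_smul, inv_mul_cancel₀ hu0, one_smul]
  have hρS : ρ ∈ Submodule.span ℂ {c : complexBetti (X ⊗ Y) (2 * (p + r)) |
      IsAbsoluteHodgeClass (n + r) (X ⊗ Y) (p + r) c} := hρeq ▸ Submodule.smul_mem _ _ hc'S
  have hρalg : ρ ∈ algebraicClasses (X ⊗ Y) (p + r) :=
    hpad ρ (isAbsoluteHodgeClass_of_isRationalClass_of_mem_span hN hXP (fun σ c ↦ hex hXP σ (p + r) c) hρrat hρS)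
  have hc'alg : c' ∈ algebraicClasses (X ⊗ Y) (p + r) := by
    rw [← hc'def, hρ]
    exact Submodule.smul_mem _ u hρalg
  -- `c = (s ≫ pr₁)_! c = pr_{1!} (s_! c)`
  have hcc : gysinMap (complexOrientationFamily hXP) (complexOrientationFamily hX)
      (Motives.AlgPoints.mapContinuous (L := ℂ) (CartesianMonoidalCategory.fst X Y))
      (show 2 * (p + r) + (2 * n - 2 * p) = 2 * (n + r) by omega)
      (show 2 * p + (2 * n - 2 * p) = 2 * n by omega) c' = c := by
    rw [← hc'def, complexGysin_eq_gysinMap hX hXP (Motives.sliceAt X y) _ (q := 2 * n - 2 * p)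
        (by omega) (by omega),
      ← LinearMap.comp_apply, ← gysinMap_comp (hμ hXP), ← Motives.AlgPoints.mapContinuous_comp,
      Motives.sliceAt_fst, Motives.AlgPoints.mapContinuous_id, gysinMap_id (hμ hX), LinearMap.id_apply]
  -- `pr_{1!}` maps `N^{p+r} H^{2(p+r)}((X ⊗ Y)(ℂ))` into `Nᵖ H²ᵖ(X(ℂ))`
  rw [← hcc]
  exact gysinMap_mem_algebraicClasses_of_isSmoothProjective hXP hX (complexOrientationFamily hXP)
    (complexOrientationFamily hX) (hμ hX) (CartesianMonoidalCategory.fst X Y) _ _ (by omega) hc'alg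

end Padding

/-! ## §2 Padding a power of a curve by the curve: the middle absolute Hodge classes of the even powers decide all powers -/

section CurvePowers

variable {C : SchemeOver ℂ}

/-- **Padding `k` times by the curve itself** (mod (N)+(E) + V-B3 + CS7 + CS8): for a smooth projective complex curve `C`
and `p ≤ N`, every absolute Hodge class of codimension `p` on `Cᴺ` is algebraic as soon as every absolute Hodge class of
codimension `p + k` on `C^{N+k}` is (§1 with `X = C^{N+j}`, `Y = C`, a complex point of `C`; `C^{N+j} × C = C^{N+j+1}`
definitionally). The hypothesis is NOT asserted. [cite: BrosnanFangNiePearlstein2009, §6 Lemma 48] [cite: KerrPearlstein2011, §3.1] -/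
theorem absoluteHodge_algebraic_curvePow_of_padding (hN : chartConjugation_canonical)
    (hex : ∀ ⦃n : ℕ⦄ ⦃X : SchemeOver ℂ⦄, IsSmoothProjective n X →
      ∀ (σ : ℂ ≃+* ℂ) (p : ℕ) (c : complexBetti X (2 * p)), ∃ s, IsConjugateClass σ X (2 * p) c s)
    (hZ : deligne1982_cycleClass_absoluteHodge) (hcup : deligne1982_cupProduct_absoluteHodge)
    (hgys : deligne1982_gysinFst_absoluteHodge) (hC : IsSmoothProjective 1 C) (N p : ℕ) (hpN : p ≤ N) :
    ∀ k : ℕ, (∀ c' : complexBetti (C.pow (N + k)) (2 * (p + k)),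
        IsAbsoluteHodgeClass (N + k) (C.pow (N + k)) (p + k) c' → c' ∈ algebraicClasses (C.pow (N + k)) (p + k)) →
      ∀ c : complexBetti (C.pow N) (2 * p), IsAbsoluteHodgeClass N (C.pow N) p c → c ∈ algebraicClasses (C.pow N) p
  | 0, h => h
  | k + 1, h => by
    refine absoluteHodge_algebraic_curvePow_of_padding hN hex hZ hcup hgys hC N p hpN k fun c' hc' ↦ ?_
    have hX : IsSmoothProjective (N + k) (C.pow (N + k)) := by simpa using hC.pow (N + k)
    obtain ⟨y⟩ := hC.nonempty_algPoints ℂ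
    exact absoluteHodge_algebraic_of_tensor_padding (n := N + k) (p := p + k) hN hex hZ hcup hgys hX hC y
      (Nat.add_le_add_right hpN k) h c' hc'

/-- **PER CURVE: the middle absolute Hodge classes of the even powers decide all powers** (mod the six facts). For ONE
smooth projective complex curve `C`: if for every `m ≥ 2` every absolute Hodge class in the middle degree `H^{2m}` of `C^{2m}`
is algebraic, then on every power `Cᴺ` every absolute Hodge class is algebraic — codimension `≤ 1` is Lefschetz `(1,1)`,
the lower half `2 ≤ p ≤ N/2` is padded `N − 2p` times into the middle of `C^{2(N−p)}` (§2), and the upper half follows by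
Deligne's Ex. 2.1 (c) (T1c; gen 68's `forall_absoluteHodge_algebraic_of_lowerHalf`). The hypothesis is NOT asserted.
[cite: BrosnanFangNiePearlstein2009, §6 Lemma 48] [cite: Deligne1982HodgeCycles, §2 Example 2.1 (c) (p. 16)]
[cite: VoisinHodgeI2002, Thm. 6.25 and Thm. 11.30] -/
theorem absoluteHodge_algebraic_curvePow_of_forall_middleDegree (hN : chartConjugation_canonical)
    (hex : ∀ ⦃n : ℕ⦄ ⦃X : SchemeOver ℂ⦄, IsSmoothProjective n X →
      ∀ (σ : ℂ ≃+* ℂ) (p : ℕ) (c : complexBetti X (2 * p)), ∃ s, IsConjugateClass σ X (2 * p) c s)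
    (hZ : deligne1982_cycleClass_absoluteHodge) (hL : deligne1982_lefschetz_absoluteHodge_iff)
    (hcup : deligne1982_cupProduct_absoluteHodge) (hgys : deligne1982_gysinFst_absoluteHodge)
    (hC : IsSmoothProjective 1 C)
    (hmid : ∀ m : ℕ, 2 ≤ m → ∀ c' : complexBetti (C.pow (2 * m)) (2 * m),
      IsAbsoluteHodgeClass (2 * m) (C.pow (2 * m)) m c' → c' ∈ algebraicClasses (C.pow (2 * m)) m)
    (N p : ℕ) (c : complexBetti (C.pow N) (2 * p)) (hc : IsAbsoluteHodgeClass N (C.pow N) p c) :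
    c ∈ algebraicClasses (C.pow N) p := by
  have hX : IsSmoothProjective N (C.pow N) := by simpa using hC.pow N
  refine forall_absoluteHodge_algebraic_of_lowerHalf hL hX (fun q h2 h2q c' hc' ↦ ?_) p c hc
  -- the lower half `2 ≤ q ≤ N/2`: pad `k := N − 2q` times into the middle of `C^{N+k} = C^{2(q+k)}`
  obtain ⟨k, hk⟩ : ∃ k, 2 * q + k = N := ⟨N - 2 * q, by omega⟩
  refine absoluteHodge_algebraic_curvePow_of_padding hN hex hZ hcup hgys hC N q (by omega) k ?_ c' hc'
  rw [show N + k = 2 * (q + k) by omega]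
  exact hmid (q + k) (by omega)

/-- **PER CURVE, in Charles–Schnell's words: `AbsoluteHodgeClassesAreAlgebraicFor N (Cᴺ)` for all `N` ⟺ the middle
absolute Hodge classes of the even powers `C^{2m}`, `m ≥ 2`, are algebraic** (mod the six facts). Neither side is asserted.
[cite: CharlesSchnell2014Notes, §11.2.5 statement 11.2.18] [cite: BrosnanFangNiePearlstein2009, §6 Lemma 48] -/
theorem forall_absoluteHodgeClassesAreAlgebraicFor_curvePow_iff_middleDegree (hN : chartConjugation_canonical)
    (hex : ∀ ⦃n : ℕ⦄ ⦃X : SchemeOver ℂ⦄, IsSmoothProjective n X →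
      ∀ (σ : ℂ ≃+* ℂ) (p : ℕ) (c : complexBetti X (2 * p)), ∃ s, IsConjugateClass σ X (2 * p) c s)
    (hZ : deligne1982_cycleClass_absoluteHodge) (hL : deligne1982_lefschetz_absoluteHodge_iff)
    (hcup : deligne1982_cupProduct_absoluteHodge) (hgys : deligne1982_gysinFst_absoluteHodge)
    (hC : IsSmoothProjective 1 C) :
    (∀ N : ℕ, AbsoluteHodgeClassesAreAlgebraicFor N (C.pow N)) ↔
      ∀ m : ℕ, 2 ≤ m → ∀ c : complexBetti (C.pow (2 * m)) (2 * m),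
        IsAbsoluteHodgeClass (2 * m) (C.pow (2 * m)) m c → c ∈ algebraicClasses (C.pow (2 * m)) m := by
  refine ⟨fun h m _ c hc ↦ (h (2 * m)).2 m c hc, fun h N ↦ ⟨?_, fun p c hc ↦
    absoluteHodge_algebraic_curvePow_of_forall_middleDegree hN hex hZ hL hcup hgys hC h N p c hc⟩⟩
  simpa only [Nat.mul_one] using nonempty_hodgeModel_holds (hC.pow N)

end CurvePowers

/-! ## §3 Row b06 is the middle-dimensional statement on the even powers of curves (mod the six facts, without c1) -/

section Row

/-- **ROW b06 ⟺ FOR EVERY SMOOTH PROJECTIVE COMPLEX CURVE `C` AND EVERY `m ≥ 2`, EVERY ABSOLUTE HODGE CLASS IN THE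
MIDDLE DEGREE `H^{2m}` OF `C^{2m}` IS ALGEBRAIC** — modulo the six class-level facts of Deligne's §2, WITHOUT Deligne's Main
Theorem (compare gen 75's hypothesis-free `hc_av_iff_curvePow_middleDegree` for `HC_AV`). `⟹`: the companion's
`absoluteHodgeImpliesAlgebraicAV_iff_curvePow_of_facts`; `⟸`: §2 per curve, then the same companion equivalence. First open
instance: `m = 2`, `H⁴((C⁴)(ℂ); ℂ)`. Neither side is asserted. [cite: BrosnanFangNiePearlstein2009, §6 Lemma 48]
[cite: Arapura2006, §1 Lemma 1.3 and §4 Lemma 4.2] [cite: DeligneMilne1982Tannakian, II Prop. 6.5]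
[cite: CharlesSchnell2014Notes, §11.2.5 statement 11.2.18] -/
theorem absoluteHodgeImpliesAlgebraicAV_iff_curvePow_middleDegree_of_facts (hN : chartConjugation_canonical)
    (hex : ∀ ⦃n : ℕ⦄ ⦃X : SchemeOver ℂ⦄, IsSmoothProjective n X →
      ∀ (σ : ℂ ≃+* ℂ) (p : ℕ) (c : complexBetti X (2 * p)), ∃ s, IsConjugateClass σ X (2 * p) c s)
    (hZ : deligne1982_cycleClass_absoluteHodge) (hL : deligne1982_lefschetz_absoluteHodge_iff)
    (hcup : deligne1982_cupProduct_absoluteHodge) (hgys : deligne1982_gysinFst_absoluteHodge) :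
    AbsoluteHodgeImpliesAlgebraicAV ↔
      ∀ (C : SchemeOver ℂ), IsSmoothProjective 1 C → ∀ m : ℕ, 2 ≤ m →
        ∀ c : complexBetti (C.pow (2 * m)) (2 * m),
          IsAbsoluteHodgeClass (2 * m) (C.pow (2 * m)) m c → c ∈ algebraicClasses (C.pow (2 * m)) m := by
  rw [absoluteHodgeImpliesAlgebraicAV_iff_curvePow_of_facts hN hex hZ hL hcup hgys]
  exact ⟨fun h C hC m _ c hc ↦ h C hC (2 * m) m c hc, fun h C hC k p y hy ↦
    absoluteHodge_algebraic_curvePow_of_forall_middleDegree hN hex hZ hL hcup hgys hC (h C hC) k p y hy⟩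

/-- **A counterexample to row b06, if any, can be moved to the MIDDLE cohomology of an even power `C^{2m}`, `m ≥ 2`, of a
smooth projective curve by absolute-Hodge means alone** (the `¬`-form, mod the six facts). Nothing is asserted about row b06.
[cite: BrosnanFangNiePearlstein2009, §6 Lemma 48] [cite: Arapura2006, §4 Lemma 4.2] -/
theorem not_absoluteHodgeImpliesAlgebraicAV_iff_exists_curvePow_middleDegree_of_facts (hN : chartConjugation_canonical)
    (hex : ∀ ⦃n : ℕ⦄ ⦃X : SchemeOver ℂ⦄, IsSmoothProjective n X →
      ∀ (σ : ℂ ≃+* ℂ) (p : ℕ) (c : complexBetti X (2 * p)), ∃ s, IsConjugateClass σ X (2 * p) c s)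
    (hZ : deligne1982_cycleClass_absoluteHodge) (hL : deligne1982_lefschetz_absoluteHodge_iff)
    (hcup : deligne1982_cupProduct_absoluteHodge) (hgys : deligne1982_gysinFst_absoluteHodge) :
    ¬ AbsoluteHodgeImpliesAlgebraicAV ↔
      ∃ C : SchemeOver ℂ, IsSmoothProjective 1 C ∧ ∃ m : ℕ, 2 ≤ m ∧
        ∃ c : complexBetti (C.pow (2 * m)) (2 * m),
          IsAbsoluteHodgeClass (2 * m) (C.pow (2 * m)) m c ∧ c ∉ algebraicClasses (C.pow (2 * m)) m := by
  rw [absoluteHodgeImpliesAlgebraicAV_iff_curvePow_middleDegree_of_facts hN hex hZ hL hcup hgys]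
  push Not
  rfl

/-- **The c1-end of the square.** Granted moreover Deligne's Main Theorem (c1, displayed `hD`), «absolute Hodge» may be
replaced by «rational `(m,m)`» on the curve powers (their Hodge classes are absolute Hodge, companion's DM II 6.27
`hodgeClasses_curvePow_absoluteHodge_of_deligne`): ROW b06 ⟺ the middle RATIONAL HODGE classes of the `C^{2m}`, `m ≥ 2`,
are algebraic — which by gen 75's hypothesis-free `hc_av_iff_curvePow_middleDegree` is `HC_AV`; i.e. this equivalence is
the familiar `row b06 ⟺ HC_AV` (mod c1) READ ON CURVE POWERS. Neither side is asserted. [cite: DeligneMilne1982Tannakian, II Cor. 6.27]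
[cite: BrosnanFangNiePearlstein2009, §6 Lemma 48] [cite: Deligne1982HodgeCycles, Main Thm. 2.11 (p. 19)] -/
theorem absoluteHodgeImpliesAlgebraicAV_iff_hodge_curvePow_middleDegree_of_deligne (hN : chartConjugation_canonical)
    (hex : ∀ ⦃n : ℕ⦄ ⦃X : SchemeOver ℂ⦄, IsSmoothProjective n X →
      ∀ (σ : ℂ ≃+* ℂ) (p : ℕ) (c : complexBetti X (2 * p)), ∃ s, IsConjugateClass σ X (2 * p) c s)
    (hZ : deligne1982_cycleClass_absoluteHodge) (hL : deligne1982_lefschetz_absoluteHodge_iff)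
    (hcup : deligne1982_cupProduct_absoluteHodge) (hgys : deligne1982_gysinFst_absoluteHodge)
    (hD : deligne1982_hodgeClasses_abelianVariety_absoluteHodge) :
    AbsoluteHodgeImpliesAlgebraicAV ↔
      ∀ (C : SchemeOver ℂ), IsSmoothProjective 1 C → ∀ m : ℕ, 2 ≤ m →
        ∀ c : complexBetti (C.pow (2 * m)) (2 * m), IsRationalClass c →
          IsOfHodgeType (2 * m) (C.pow (2 * m)) (2 * m) m m c → c ∈ algebraicClasses (C.pow (2 * m)) m := by
  rw [absoluteHodgeImpliesAlgebraicAV_iff_curvePow_middleDegree_of_facts hN hex hZ hL hcup hgys]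
  refine ⟨fun h C hC m hm c hc hpp ↦ h C hC m hm c
      (hodgeClasses_curvePow_absoluteHodge_of_deligne hN hex hZ hcup hgys hD hC (2 * m) m c hc hpp),
    fun h C hC m hm c hc ↦ h C hC m hm c hc.isRationalClass hc.isOfHodgeType⟩

end Row

/-! ## Audit: nothing is decided here

Every theorem above is an implication between OPEN per-variety statements or an equivalence with the OPEN row b06, each
modulo the displayed named facts of record; row b06 is never proved, `HC_CM` / `HC_AV` do not occur. -/

end Summit.HodgeConjecture.HodgeConjecture.Ring2.Hypotheses

end
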